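import Mathlib.LinearAlgebra.Matrix.Rank
import Mathlib.LinearAlgebra.Matrix.GeneralLinearGroup.Defs
import Mathlib.LinearAlgebra.Matrix.Permutation
import Mathlib.LinearAlgebra.Matrix.NonsingularInverse
import Mathlib.FieldTheory.IsAlgClosed.Basic
import Literature.Computability.AlgebraicComplexity.OrbitClosure
import Literature.Computability.AlgebraicComplexity.QuantumFunctionals
import Literature.Computability.AlgebraicComplexity.KumarLatinRectangles
import Literature.Computability.AlgebraicComplexity.DM16NonCommutativeRank
import HarnessLib

/-!
# Bläser–Ikenmeyer–Lysikov–Pandey–Schreyer: minrank of 3-tensors, minrank varieties as orbit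
# closures, their stabilizers and equations (typed statements of §5–§7)

Source: M. Bläser, C. Ikenmeyer, V. Lysikov, A. Pandey, F.-O. Schreyer, *Variety membership
testing, algebraic natural proofs, and geometric complexity theory*, arXiv:1911.02534, bib key
`BlaserIkenmeyerLysikovPandeySchreyer2019` (refereed version: *On the orbit closure containment
problem and slice rank of tensors*, SODA 2021, doi:10.1137/1.9781611976465.152). NUMBERING = the
flat numbering of the held arXiv text (`lit read paper:arxiv-1911.02534`, TeX chunks `pNNNN`):
Def 13 (p0022), Thm 14, Def 15, Lemmas 16–18, `T_{k,n,r}`, Thm 19 (p0023), Cor 20, Thm 21, Thm 22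
(p0024), Thm 23, Thm 24, Cor 25 (p0025), statement 26 (`LRC(α,β)`), Thm 27 (p0026). The §8 results
(Thms 33–36, Cor 37, Def 38, Cor 42) are the sibling file
`Literature/Barriers/ValiantsHypothesis/BILPS19MembershipHardness.lean`. Honest framing (val-lit):
published statements TYPED as cite-tagged `def … : Prop` named facts (D-0014) over the tree's
vocabulary (`actTensor`, `zariskiClosure`, `Matrix.rank`, `Kumar2015.IsLatinRect`) plus small
proved API lemmas; nothing here bears on `VP ≠ VNP`. Statement 26 is NOT asserted: it is the
hypothesis predicate `latinRectangleCondition` of Thm 27.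

Conventions made explicit. (1) `T ∈ U ⊗ V ⊗ W`, `U = F^ι`, `V = F^κ`, `W = F^μ`, is
`T : ι → κ → μ → F` (slices `T a`); "`Tx`" is `contract3 T x` (`U*` identified with `ι → F`); the
affine point of `T` is `trilinearPt T`, orbit closures are `orbitClosure3 T = zariskiClosure
(trilinearPt '' glOrbit3 T)`. (2) Fields: §6 opens "Over algebraically closed fields" and Thm 14 is
stated for `F` algebraically closed; Def 15 – Thm 22 carry no separate clause and are typed with
`[IsAlgClosed F]` (safe reading; Lemmas 17–18 hold over any field by the printed proofs); §7 works
"over `ℂ` (or over algebraically closed field of characteristic `0`)": Thms 23, 24, Cor 25, Thm 27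
carry `[IsAlgClosed F] [CharZero F]`. (3) `T_{k,n,r} ∈ U ⊗ L ⊗ L`, `U = F^k`, `L = F^r ⊕ (F^n)^{k-1}`,
is typed with `k = k'+1`, slice index `Option (Fin k')` (`none` = `e_1`) and `L`-index
`BIdx k' n r = Fin r ⊕ (Fin n × Fin k')`. (4) Thm 21 is typed as an explicit SET description of the
stabilizer via the printed embedding `(z, Z, σ) ↦ (P_σ diag(z), P̃_σ diag(Z), P̃_σ diag((z_i Z_i)^{-T}))`;
the abstract isomorphism type `[(GL_r × GL_1) × (GL_n × GL_1)^{k-1}] ⋊ S_{k-1}` is this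
parametrisation and is not typed separately; it carries `1 ≤ r` besides the printed `r < n` (for
`r = 0` the first slice of `T_{k,n,0}` vanishes and the first column of `A` is unconstrained) —
WEAKER by an explicit hypothesis; Thm 22 is typed under the same standing hypotheses. (5) Thm 23
("size-`s` minors of `M_{T,r}` lie in `I(𝓜_r)`", `s = dim S^{r+1}U` = number of columns of
`M_{T,r}`) is typed as the equivalent column dependence: the column at the monomial `x^d`,
`|d| = r+1`, is the vector of `x^d`-coefficients of the `(r+1)`-minors of `Tx` (rows = all
selections `Fin (r+1) → κ, μ`; repeated/zero rows do not affect column dependence; in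
characteristic `0` the columns of `M_{T,r}` are these vectors up to nonzero multinomial factors).
(6) Thm 24's bound is rational-valued and typed in `ℚ`; `F_{T,p}` is the matrix `koszulMatrix p T`
with the tree's wedge signs `wedgeSign` (`DM16NonCommutativeRank.lean`). (7) Thm 27 is typed
WEAKER: a nonzero homogeneous degree-`km` equation of `𝓜_r` exists (its isotypic type
`((k×m),(m×k),(m×k))` is not typed).
-/

noncomputable section

open MvPolynomial Matrix

namespace Literature.Computability.AlgebraicComplexity

/-! ### Def 13 / Def 15: contraction, minrank, minrank varieties -/

section Minrank

variable {F : Type*} [Field F] {ι κ μ : Type*} [Fintype ι] [Fintype μ]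

/-- The contraction `Tx := x(e_1) A_1 + ⋯ + x(e_k) A_k ∈ V ⊗ W` of a tensor `T = ∑ e_i ⊗ A_i ∈
U ⊗ V ⊗ W` with a linear form `x ∈ U*` (BILPS §2.2, p0008; §5, p0022). [cite: BlaserIkenmeyerLysikovPandeySchreyer2019, §5 (before Def. 13)] -/
def contract3 (T : ι → κ → μ → F) (x : ι → F) : Matrix κ μ F :=
  fun b c => ∑ a, x a * T a b c

/-- **BILPS Def 13 (minrank).** "The minrank of a tensor `T ∈ U ⊗ V ⊗ W` is the minimal number `r`
such that there exists a nonzero `x ∈ U*` with `rk(Tx) = r`." (p0022:L25). Junk value `0` (`sInf ∅`)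
when `U = 0`. [cite: BlaserIkenmeyerLysikovPandeySchreyer2019, Def. 13] -/
def minrank (T : ι → κ → μ → F) : ℕ :=
  sInf {r | ∃ x : ι → F, x ≠ 0 ∧ (contract3 T x).rank = r}

variable (F) in
/-- **BILPS Def 15 (the affine minrank variety `𝓜_{U ⊗ V ⊗ W, r}`).** "`{T ∈ U ⊗ V ⊗ W | ∃ x ≠ 0:
rk(Tx) ≤ r}` the affine minrank variety, or just the minrank variety" (p0023:L29–40); by Thm 14 it
is exactly the set of tensors of minrank at most `r` and is Zariski closed over an algebraically
closed field. [cite: BlaserIkenmeyerLysikovPandeySchreyer2019, Def. 15] -/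
def minrankSet (r : ℕ) : Set (ι → κ → μ → F) :=
  {T | ∃ x : ι → F, x ≠ 0 ∧ (contract3 T x).rank ≤ r}

omit [Fintype μ] in
/-- Unfolding of the contraction. [cite: BlaserIkenmeyerLysikovPandeySchreyer2019, §5] -/
theorem contract3_apply (T : ι → κ → μ → F) (x : ι → F) (b : κ) (c : μ) :
    contract3 T x b c = ∑ a, x a * T a b c := rfl

/-- Membership in `𝓜_r`. [cite: BlaserIkenmeyerLysikovPandeySchreyer2019, Def. 15] -/
theorem mem_minrankSet_iff (r : ℕ) (T : ι → κ → μ → F) :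
    T ∈ minrankSet F r ↔ ∃ x : ι → F, x ≠ 0 ∧ (contract3 T x).rank ≤ r :=
  Iff.rfl

/-- `minrank T ≤ rk(Tx)` for every nonzero `x`. [cite: BlaserIkenmeyerLysikovPandeySchreyer2019, Def. 13] -/
theorem minrank_le {T : ι → κ → μ → F} {x : ι → F} (hx : x ≠ 0) :
    minrank T ≤ (contract3 T x).rank :=
  Nat.sInf_le ⟨x, hx, rfl⟩

/-- `𝓜_r ⊆ 𝓜_{r'}` for `r ≤ r'` ("an ascending chain", §2.6). [cite: BlaserIkenmeyerLysikovPandeySchreyer2019, Def. 15] -/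
theorem minrankSet_mono {r r' : ℕ} (h : r ≤ r') :
    (minrankSet F r : Set (ι → κ → μ → F)) ⊆ minrankSet F r' :=
  fun _ ⟨x, hx, hr⟩ => ⟨x, hx, hr.trans h⟩

/-- For `U ≠ 0` the minrank variety `𝓜_r` is the set of tensors of minrank `≤ r` ("This affine cone
is exactly the set of tensors of minrank at most `r`", proof of Thm 14, p0023:L27).
[cite: BlaserIkenmeyerLysikovPandeySchreyer2019, Thm. 14 (proof)] -/
theorem mem_minrankSet_iff_minrank_le [Nonempty ι] (r : ℕ) (T : ι → κ → μ → F) :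
    T ∈ minrankSet F r ↔ minrank T ≤ r := by
  refine ⟨fun ⟨x, hx, hr⟩ => (minrank_le hx).trans hr, fun h => ?_⟩
  have hne : {r | ∃ x : ι → F, x ≠ 0 ∧ (contract3 T x).rank = r}.Nonempty :=
    ⟨_, fun _ => 1, one_ne_zero, rfl⟩
  obtain ⟨x, hx, hxr⟩ := Nat.sInf_mem hne
  exact ⟨x, hx, hxr.le.trans h⟩

end Minrank

/-! ### Affine points, `GL × GL × GL`-orbits, orbit closures, stabilizers of 3-tensors -/

section Points

variable {F : Type*} {ι κ μ : Type*}

/-- The point of affine space `F^{ι × κ × μ}` given by a tensor (coordinates `T_{abc}`; cf. the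
tree's cubic `tensorPt`). [cite: BlaserIkenmeyerLysikovPandeySchreyer2019, §1.4 (coefficient vectors)] -/
def trilinearPt (T : ι → κ → μ → F) : ι × κ × μ → F :=
  fun p => T p.1 p.2.1 p.2.2

/-- `trilinearPt` is injective (a tensor is determined by its coefficient vector, §1.4).
[cite: BlaserIkenmeyerLysikovPandeySchreyer2019, §1.4] -/
theorem trilinearPt_injective : Function.Injective (trilinearPt : (ι → κ → μ → F) → _) :=
  fun _ _ h => funext fun a => funext fun b => funext fun c => congr_fun h (a, b, c)

end Points

section Orbits

variable {F : Type*} [Field F] {ι κ μ : Type*}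
variable [Fintype ι] [Fintype κ] [Fintype μ] [DecidableEq ι] [DecidableEq κ] [DecidableEq μ]

/-- The orbit `(GL(U) × GL(V) × GL(W))·T` under "the standard action … on `U ⊗ V ⊗ W`" (§1.1,
p0003: "`(A,B,C)·u ⊗ v ⊗ w = Au ⊗ Bv ⊗ Cw` and on arbitrary tensors by linear continuation"; the
tree's `actTensor`). [cite: BlaserIkenmeyerLysikovPandeySchreyer2019, §1.1] -/
def glOrbit3 (T : ι → κ → μ → F) : Set (ι → κ → μ → F) :=
  {T' | ∃ (A : GL ι F) (B : GL κ F) (C : GL μ F),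
    T' = actTensor (A : Matrix ι ι F) (B : Matrix κ κ F) (C : Matrix μ μ F) T}

/-- The orbit closure `\overline{(GL × GL × GL)·T}` "in the Zariski topology" (§1.1, p0003), as a
subset of affine space. [cite: BlaserIkenmeyerLysikovPandeySchreyer2019, §1.1] -/
def orbitClosure3 (T : ι → κ → μ → F) : Set (ι × κ × μ → F) :=
  zariskiClosure (trilinearPt '' glOrbit3 T)

/-- The stabilizer `Stab T = {(A,B,C) | (A ⊗ B ⊗ C)T = T}` (§2.2, Thm 21), as a set of triples.
[cite: BlaserIkenmeyerLysikovPandeySchreyer2019, §2.2] -/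
def stab3 (T : ι → κ → μ → F) : Set (GL ι F × GL κ F × GL μ F) :=
  {g | actTensor (g.1 : Matrix ι ι F) (g.2.1 : Matrix κ κ F) (g.2.2 : Matrix μ μ F) T = T}

/-- `T` lies in its own orbit (§1.1: `1 · s = s`). [cite: BlaserIkenmeyerLysikovPandeySchreyer2019, §1.1] -/
theorem mem_glOrbit3_self (T : ι → κ → μ → F) : T ∈ glOrbit3 T :=
  ⟨1, 1, 1, by simp⟩

/-- The orbit is contained in the orbit closure (§1.1). [cite: BlaserIkenmeyerLysikovPandeySchreyer2019, §1.1] -/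
theorem trilinearPt_mem_orbitClosure3 {T T' : ι → κ → μ → F} (h : T' ∈ glOrbit3 T) :
    trilinearPt T' ∈ orbitClosure3 T :=
  subset_zariskiClosure _ ⟨T', h, rfl⟩

end Orbits

/-! ### Thm 14, Lemmas 17–18 -/

/-- **BILPS Thm 14.** "Let `U`, `V`, `W` be vector spaces over an algebraically closed field `F`. The
set of all tensors `T ∈ U ⊗ V ⊗ W` with minrank at most `r` is Zariski closed." (p0023:L5; proof:
image of the projective incidence variety `{([T],[x]) | rk(Tx) ≤ r}` under the first projection).
Typed: the Zariski closure of (the points of) `𝓜_r` is `𝓜_r`. [cite: BlaserIkenmeyerLysikovPandeySchreyer2019, Thm. 14] -/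
def BILPS2019_thm14 : Prop :=
  ∀ (F : Type) [Field F] [IsAlgClosed F] (k m n r : ℕ),
    zariskiClosure (trilinearPt '' (minrankSet F r : Set (Fin k → Fin m → Fin n → F))) =
      trilinearPt '' (minrankSet F r : Set (Fin k → Fin m → Fin n → F))

/-- **BILPS Lemma 17.** "Let `dim U = k`, `dim V = n` and `dim W > s = n(k-1) + r`. Then
`𝓜_{U ⊗ V ⊗ W, r} = ⋃_{W' ⊂ W, dim W' = s} 𝓜_{U ⊗ V ⊗ W', r}`." (p0023:L54). Typed (the inclusion `⊇`
being Lemma 16, trivial in coordinates since `rk(Tx)` does not depend on the ambient space): every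
`T ∈ 𝓜_r` has all its `W`-legs inside one `s`-dimensional subspace `W'`.
[cite: BlaserIkenmeyerLysikovPandeySchreyer2019, Lemma 17] -/
def BILPS2019_lemma17 : Prop :=
  ∀ (F : Type) [Field F] [IsAlgClosed F] (k n w r : ℕ), n * (k - 1) + r < w →
    ∀ T : Fin k → Fin n → Fin w → F, T ∈ (minrankSet F r : Set (Fin k → Fin n → Fin w → F)) →
      ∃ W' : Submodule F (Fin w → F), Module.finrank F W' = n * (k - 1) + r ∧
        ∀ a b, (fun c => T a b c) ∈ W'

/-- **BILPS Lemma 18.** "The variety `𝓜_{U ⊗ V ⊗ W, r}` is invariant under the standard action of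
`GL(U) × GL(V) × GL(W)` on `U ⊗ V ⊗ W`." (p0023:L70; "if `rk(Tx) ≤ r`, then
`(F ⊗ G ⊗ H)T · (F^{-*}x) = (G ⊗ H)(Tx)` also has rank at most `r`").
[cite: BlaserIkenmeyerLysikovPandeySchreyer2019, Lemma 18] -/
def BILPS2019_lemma18 : Prop :=
  ∀ (F : Type) [Field F] [IsAlgClosed F] (k m n r : ℕ) (T : Fin k → Fin m → Fin n → F)
    (A : GL (Fin k) F) (B : GL (Fin m) F) (C : GL (Fin n) F),
    T ∈ (minrankSet F r : Set (Fin k → Fin m → Fin n → F)) →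
      actTensor (↑A : Matrix (Fin k) (Fin k) F) (↑B : Matrix (Fin m) (Fin m) F)
        (↑C : Matrix (Fin n) (Fin n) F) T ∈ (minrankSet F r : Set (Fin k → Fin m → Fin n → F))

/-! ### §6.1: the tensors `T_{k,n,r}` and Thm 19 / Cor 20 -/

section BILPSTensor

/-- Index set of `L = F^r ⊕ (F^n)^{k-1}` (`s = n(k-1) + r` coordinates), `k = k' + 1`: `inl j` =
coordinate `e_{1j}` of `L_1 = F^r`, `inr (j, i)` = coordinate `e_{(i+2) j}` of `L_{i+2} = F^n`.
[cite: BlaserIkenmeyerLysikovPandeySchreyer2019, §6.1] -/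
abbrev BIdx (k' n r : ℕ) : Type := Fin r ⊕ (Fin n × Fin k')

variable (F : Type*) [Field F]

/-- **The tensor `T_{k,n,r} = e_1 ⊗ (∑_{j ≤ r} e_{1j} ⊗ e_{1j}) + ∑_{i=2}^{k} e_i ⊗ (∑_{j ≤ n}
e_{ij} ⊗ e_{ij}) ∈ U ⊗ L ⊗ L`** (p0023:L84: "the `i`-th layer … is a block matrix with the only
nonzero block being a diagonal matrix in `L_i ⊗ L_i`"), slices indexed by `Option (Fin k')`
(`none` = `e_1`). [cite: BlaserIkenmeyerLysikovPandeySchreyer2019, §6.1 (definition of T_{k,n,r})] -/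
def bilpsTensor (k' n r : ℕ) : Option (Fin k') → BIdx k' n r → BIdx k' n r → F
  | none, Sum.inl j, Sum.inl j' => if j = j' then 1 else 0
  | some i, Sum.inr (j, i₁), Sum.inr (j', i₂) => if i₁ = i ∧ i₂ = i ∧ j = j' then 1 else 0
  | _, _, _ => 0

end BILPSTensor

/-- **BILPS Cor 20.** "Let `dim U = k` and `dim V = n`. Suppose `V` and `W` are subspaces of a vector
space `L` of dimension `s = (k-1)n + r`. Then `𝓜_{U ⊗ V ⊗ W, r} = \overline{(GL(U) × GL(L) × GL(L))
T_{k,n,r}} ∩ (U ⊗ V ⊗ W)`." (p0024:L1). Typed in the coordinates of the module docstring: for a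
tensor `T ∈ U ⊗ L ⊗ L` whose `V`-legs lie in an `n`-dimensional `V ≤ L` and whose `W`-legs lie in
`W ≤ L`, membership in `𝓜_r` is membership of its point in the orbit closure of `T_{k,n,r}`.
[cite: BlaserIkenmeyerLysikovPandeySchreyer2019, Cor. 20] -/
def BILPS2019_cor20 : Prop :=
  ∀ (F : Type) [Field F] [IsAlgClosed F] (k' n r : ℕ) (V W : Submodule F (BIdx k' n r → F)),
    Module.finrank F V = n →
    ∀ T : Option (Fin k') → BIdx k' n r → BIdx k' n r → F,
      (∀ a c, (fun b => T a b c) ∈ V) → (∀ a b, (fun c => T a b c) ∈ W) →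
        (T ∈ (minrankSet F r : Set (Option (Fin k') → BIdx k' n r → BIdx k' n r → F)) ↔
          trilinearPt T ∈ orbitClosure3 (bilpsTensor F k' n r))

/-- **BILPS Thm 19.** "Let `V` be an `n`-dimensional subspace of `L`. Then `𝓜_{U ⊗ V ⊗ L, r} =
\overline{(GL_k × GL_s × GL_s) T_{k,n,r}} ∩ (U ⊗ V ⊗ L)`." (p0023:L92) — the case `W = L` of Cor 20.
[cite: BlaserIkenmeyerLysikovPandeySchreyer2019, Thm. 19] -/
def BILPS2019_thm19 : Prop :=
  ∀ (F : Type) [Field F] [IsAlgClosed F] (k' n r : ℕ) (V : Submodule F (BIdx k' n r → F)),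
    Module.finrank F V = n →
    ∀ T : Option (Fin k') → BIdx k' n r → BIdx k' n r → F,
      (∀ a c, (fun b => T a b c) ∈ V) →
        (T ∈ (minrankSet F r : Set (Option (Fin k') → BIdx k' n r → BIdx k' n r → F)) ↔
          trilinearPt T ∈ orbitClosure3 (bilpsTensor F k' n r))

/-- Thm 19 from Cor 20 (take `W = L`). [cite: BlaserIkenmeyerLysikovPandeySchreyer2019, Thm. 19] -/
theorem BILPS2019_thm19_of_cor20 (h : BILPS2019_cor20) : BILPS2019_thm19 :=
  fun F _ _ k' n r V hV T hTV => h F k' n r V ⊤ hV T hTV (fun _ _ => Submodule.mem_top)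

/-! ### Thm 21 (stabilizer of `T_{k,n,r}`) and Thm 22 (characterisation by the stabilizer) -/

section Stabilizer

variable (F : Type*) [Field F] {k' n r : ℕ}

/-- The block permutation `P̃_σ` of `L = L_1 ⊕ L_2 ⊕ ⋯ ⊕ L_k` permuting the last `k-1` summands by
`σ` (Thm 21: "`S_{k-1}` … permutes the last `k-1` coordinates of `F^k` and the last `k-1` summands
… simultaneously"). [cite: BlaserIkenmeyerLysikovPandeySchreyer2019, Thm. 21] -/
def blockPerm (σ : Equiv.Perm (Fin k')) : Equiv.Perm (BIdx k' n r) :=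
  Equiv.sumCongr (Equiv.refl (Fin r)) (Equiv.prodCongr (Equiv.refl (Fin n)) σ)

/-- The block-diagonal matrix `diag(Z_1, Z_2, …, Z_k)` on `L = F^r ⊕ (F^n)^{k-1}`.
[cite: BlaserIkenmeyerLysikovPandeySchreyer2019, Thm. 21] -/
def blockDiag3 (Z₀ : Matrix (Fin r) (Fin r) F) (Z : Fin k' → Matrix (Fin n) (Fin n) F) :
    Matrix (BIdx k' n r) (BIdx k' n r) F :=
  Matrix.fromBlocks Z₀ 0 0 (Matrix.blockDiagonal Z)

/-- The explicit stabilizer elements of Thm 21: for `σ ∈ S_{k-1}`, units `z_1, …, z_k` and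
`Z_1 ∈ GL_r`, `Z_2, …, Z_k ∈ GL_n`, the triple `(diag(z_1,…,z_k), diag(Z_1,…,Z_k),
diag((z_1 Z_1)^{-T}, …, (z_k Z_k)^{-T}))` followed by the simultaneous permutation of the last `k-1`
slices / summands (p0024:L5–11). [cite: BlaserIkenmeyerLysikovPandeySchreyer2019, Thm. 21] -/
def IsBILPSStabElement (g : GL (Option (Fin k')) F × GL (BIdx k' n r) F × GL (BIdx k' n r) F) :
    Prop :=
  ∃ (σ : Equiv.Perm (Fin k')) (z : Option (Fin k') → Fˣ) (Z₀ : GL (Fin r) F)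
    (Z : Fin k' → GL (Fin n) F),
    (↑g.1 : Matrix (Option (Fin k')) (Option (Fin k')) F) =
        Equiv.Perm.permMatrix F (Equiv.optionCongr σ) * Matrix.diagonal (fun a => (z a : F)) ∧
      (↑g.2.1 : Matrix (BIdx k' n r) (BIdx k' n r) F) =
        Equiv.Perm.permMatrix F (blockPerm (n := n) (r := r) σ) *
          blockDiag3 F (↑Z₀ : Matrix (Fin r) (Fin r) F) (fun i => (↑(Z i) : Matrix (Fin n) (Fin n) F)) ∧
      (↑g.2.2 : Matrix (BIdx k' n r) (BIdx k' n r) F) =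
        Equiv.Perm.permMatrix F (blockPerm (n := n) (r := r) σ) *
          blockDiag3 F (((z none : F) • (↑Z₀ : Matrix (Fin r) (Fin r) F))⁻¹)ᵀ
            (fun i => (((z (some i) : F) • (↑(Z i) : Matrix (Fin n) (Fin n) F))⁻¹)ᵀ)

end Stabilizer

/-- **BILPS Thm 21 (stabilizer of `T_{k,n,r}`).** "If `r < n`, then the stabilizer of `T_{k,n,r}` in
`GL_k × GL_s × GL_s` is isomorphic to `[(GL_r × GL_1) × (GL_n × GL_1)^{k-1}] ⋊ S_{k-1}`. The element
`(Z_1, z_1, …, Z_k, z_k)` is included into `GL_k × GL_s × GL_s` via `(diag(z_1, …, z_k), diag(Z_1,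
…, Z_k), diag((z_1 Z_1)^{-T}, …, (z_k Z_k)^{-T}))` and the `S_{k-1}` factor permutes the last `k-1`
coordinates of `F^k` and the last `k-1` summands of `W` simultaneously." (p0024:L5–11). Typed as the
set description `Stab(T_{k,n,r}) = {explicit elements}` (module docstring), with the extra
hypothesis `1 ≤ r` (module docstring). [cite: BlaserIkenmeyerLysikovPandeySchreyer2019, Thm. 21] -/
def BILPS2019_thm21 : Prop :=
  ∀ (F : Type) [Field F] [IsAlgClosed F] (k' n r : ℕ), 1 ≤ r → r < n →
    stab3 (bilpsTensor F k' n r) = {g | IsBILPSStabElement F g}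

/-- **BILPS Thm 22 (`T_{k,n,r}` is characterised by its stabilizer).** "Suppose `T` is a tensor in
`F^k ⊗ W ⊗ W`. If `Stab T = Stab T_{k,n,r}`, then `T` lies in the orbit `(GL_k × GL_s × GL_s)
T_{k,n,r}`. If `Stab T ⊇ Stab T_{k,n,r}`, then `T ∈ \overline{(GL_k × GL_s × GL_s) T_{k,n,r}}`."
(p0024:L47). Typed under the standing hypotheses of Thm 21 (`1 ≤ r < n`, `F` algebraically
closed). [cite: BlaserIkenmeyerLysikovPandeySchreyer2019, Thm. 22] -/
def BILPS2019_thm22 : Prop :=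
  ∀ (F : Type) [Field F] [IsAlgClosed F] (k' n r : ℕ), 1 ≤ r → r < n →
    ∀ T : Option (Fin k') → BIdx k' n r → BIdx k' n r → F,
      (stab3 T = stab3 (bilpsTensor F k' n r) → T ∈ glOrbit3 (bilpsTensor F k' n r)) ∧
      (stab3 (bilpsTensor F k' n r) ⊆ stab3 T → trilinearPt T ∈ orbitClosure3 (bilpsTensor F k' n r))

/-! ### §7.1 Basic equations (Thm 23) -/

section BasicEquations

variable {F : Type*} [Field F] {ι κ μ : Type*} [Fintype ι]

/-- The matrix of linear forms `Tx ∈ F[x_1, …, x_k]^{κ × μ}` (the slice at a generic `x ∈ U*`).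
[cite: BlaserIkenmeyerLysikovPandeySchreyer2019, §7.1] -/
def contractPoly (T : ι → κ → μ → F) : Matrix κ μ (MvPolynomial ι F) :=
  fun b c => ∑ a, X a * C (T a b c)

variable [DecidableEq κ] [DecidableEq μ]

/-- The column of `M_{T,r}` at the monomial `x^d`, `|d| = r + 1`: the vector of `x^d`-coefficients of
the `(r+1) × (r+1)` minors of `Tx` ("the polynomial map sending `x` to `(Tx)^{∧(r+1)}` extends to a
linear map `M_{T,r} : S^{r+1}U → Λ^{r+1}V* ⊗ Λ^{r+1}W*`", p0025:L24). Rows are indexed by all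
selections `Fin (r+1) → κ`, `Fin (r+1) → μ` (module docstring).
[cite: BlaserIkenmeyerLysikovPandeySchreyer2019, §7.1 (M_{T,r})] -/
def minorCoeffColumn (r : ℕ) (T : ι → κ → μ → F) (d : ι →₀ ℕ) :
    (Fin (r + 1) → κ) × (Fin (r + 1) → μ) → F :=
  fun IJ => coeff d (Matrix.det ((contractPoly T).submatrix IJ.1 IJ.2))

end BasicEquations

/-- **BILPS Thm 23 (basic equations).** "Let `s = dim S^{r+1}U = binom(k+r, r+1)`. Size `s` minors of
`M_{T,r}` lie in the ideal `I(𝓜_r)`." (p0025:L27; proof: at `T ∈ 𝓜_r` the map `M_{T,r}` kills the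
nonzero vector `x^{⊗(r+1)}`, so its rank is `< s`). Typed (module docstring) as: at every `T ∈ 𝓜_r`
the columns of `M_{T,r}`, indexed by the monomials of degree `r+1` in `k` variables, are linearly
dependent; over an algebraically closed field of characteristic `0` (§7).
[cite: BlaserIkenmeyerLysikovPandeySchreyer2019, Thm. 23] -/
def BILPS2019_thm23 : Prop :=
  ∀ (F : Type) [Field F] [IsAlgClosed F] [CharZero F] (k m n r : ℕ)
    (T : Fin k → Fin m → Fin n → F), T ∈ (minrankSet F r : Set (Fin k → Fin m → Fin n → F)) →
      ¬ LinearIndependent F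
        (fun d : {d : Fin k →₀ ℕ // d.degree = r + 1} => minorCoeffColumn r T d.1)

/-! ### §7.2 Koszul flattenings (Thm 24, Cor 25) -/

section Koszul

variable {F : Type*} [Field F] {k m n : ℕ}

/-- **The Koszul flattening `F_{T,p} : Λ^p U* ⊗ V → Λ^{p+1} U* ⊗ W*`**, "If `T = ∑_i x_i ⊗ A_i`, then
`F_{T,p}` sends `y ⊗ v` to `∑_i (x_i ∧ y) ⊗ A_i v`" (p0025:L48), as a matrix: rows `(S', c)` with
`|S'| = p+1`, columns `(S, b)` with `|S| = p`, entry `± T_{i b c}` when `S' = S ∪ {i}`, else `0`.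
[cite: BlaserIkenmeyerLysikovPandeySchreyer2019, §7.2 (F_{T,p})] -/
def koszulMatrix (p : ℕ) (T : Fin k → Fin m → Fin n → F) :
    Matrix ({S : Finset (Fin k) // S.card = p + 1} × Fin n)
      ({S : Finset (Fin k) // S.card = p} × Fin m) F :=
  fun Sc Sb => ∑ i : Fin k,
    if (Sb.1 : Finset (Fin k)) ⊆ Sc.1 ∧ i ∈ (Sc.1 : Finset (Fin k)) ∧ i ∉ (Sb.1 : Finset (Fin k))
    then wedgeSign F i Sb.1 * T i Sb.2 Sc.2 else 0

end Koszul

/-- **BILPS Thm 24 (Koszul flattening rank bound).** "Let `0 < p < k`. If `T ∈ 𝓜_{U* ⊗ V* ⊗ W*, r}`,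
then `rk F_{T,p} ≤ binom(k-1, p) (r + min(m, (k-p-1)/(p+1)·n) + min(n, p/(k-p)·m))`." (p0025:L50;
`k = dim U`, `m = dim V`, `n = dim W`). The bound is rational-valued and typed in `ℚ`; §7 field
hypotheses. [cite: BlaserIkenmeyerLysikovPandeySchreyer2019, Thm. 24] -/
def BILPS2019_thm24 : Prop :=
  ∀ (F : Type) [Field F] [IsAlgClosed F] [CharZero F] (k m n p r : ℕ)
    (T : Fin k → Fin m → Fin n → F), 0 < p → p < k →
      T ∈ (minrankSet F r : Set (Fin k → Fin m → Fin n → F)) →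
        ((koszulMatrix p T).rank : ℚ) ≤
          ((k - 1).choose p : ℚ) *
            (r + min (m : ℚ) (((k : ℚ) - p - 1) / (p + 1) * n) + min (n : ℚ) ((p : ℚ) / (k - p) * m))

/-- **BILPS Cor 25.** "If `n = (p+1)/(k-p)·m`, and `r < m/(k-p)`, then `rk F_{T,p} < dim(Λ^p U* ⊗ V)`"
(p0025:L77; `dim(Λ^p U* ⊗ V) = binom(k, p)·m`), for `T ∈ 𝓜_r` and `0 < p < k` as in Thm 24 (in
particular the minors of `F_{T,p}` of that size are equations for `𝓜_r`, nontrivial for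
`k = 2p+1`, `n = m` by [Landsberg 2015], p0026:L4–6).
[cite: BlaserIkenmeyerLysikovPandeySchreyer2019, Cor. 25] -/
def BILPS2019_cor25 : Prop :=
  ∀ (F : Type) [Field F] [IsAlgClosed F] [CharZero F] (k m n p r : ℕ)
    (T : Fin k → Fin m → Fin n → F), 0 < p → p < k → (k - p) * n = (p + 1) * m →
      (r : ℚ) < (m : ℚ) / (k - p) → T ∈ (minrankSet F r : Set (Fin k → Fin m → Fin n → F)) →
        (koszulMatrix p T).rank < k.choose p * m

/-! ### §7.3 Equations from rectangular designs: the Latin-rectangle condition and Thm 27 -/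

section LatinRectangles

/-- The column-determinant polynomial of an `α × β` array `R` with entries in `[β]` (labels of the
vectors `u_1, …, u_β ∈ ℂ^α`): `det(R) = ∏_j det(u_{R_{1j}}, …, u_{R_{αj}})` in the indeterminate
coordinates `X_{v,a}` of the vectors (p0026:L13–17). [cite: BlaserIkenmeyerLysikovPandeySchreyer2019, §7.3 (column-determinant)] -/
def colDetPoly {α β : ℕ} (R : Fin α → Fin β → Fin β) : MvPolynomial (Fin β × Fin α) ℤ :=
  ∏ j : Fin β, Matrix.det (Matrix.of fun a p : Fin α => (X (R p j, a) : MvPolynomial (Fin β × Fin α) ℤ))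

/-- The sum `∑_L det(L)` over all `α × β` Latin rectangles for `𝒰 = {u_1, …, u_β}` ("in each row and
in each column we have each entry from `𝒰` at most once", p0026:L12 — for `α ≤ β` these are Kumar's
Latin `(α, β)`-rectangles, the tree's `Kumar2015.IsLatinRect`: rows bijective, columns injective),
as a polynomial in the coordinates of the `u_v`. [cite: BlaserIkenmeyerLysikovPandeySchreyer2019, §7.3] -/
def latinRectSumPoly (α β : ℕ) : MvPolynomial (Fin β × Fin α) ℤ :=
  ∑ R ∈ @Finset.filter _ (fun R : Fin α → Fin β → Fin β => Kumar2015.IsLatinRect R)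
      (Classical.decPred _) Finset.univ,
    colDetPoly R

/-- **The Latin-rectangle condition `LRC(α, β)`** (BILPS §7.3, statement 26, p0026:L23: "Choose a set
`𝒰` of `β` many vectors in `ℂ^α` generically. Then `∑_L det(L) ≠ 0`, where the sum is over all Latin
Rectangles for `𝒰`"), rendered as non-vanishing of the polynomial `∑_L det(L)` in the coordinates of
`𝒰` (generic non-vanishing over `ℂ` is non-vanishing of the integer polynomial). This is the
HYPOTHESIS predicate of Thm 27, not an asserted fact: the source records it for `α = 1` (trivial),
`α = 2` (Hermite reciprocity), `α ≤ 5` [MN05, McK08, CIM15], `(β, β)` with `β = p ± 1` (Alon–Tarsi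
= Huang–Rota, [Dri98, Gly10]) and `LRC(β,β) ⇒ LRC(α,β)` [Kum15]; its general validity (every `α` and
every even `β ≥ α`) is NOT established and is not asserted anywhere in this file.
[cite: BlaserIkenmeyerLysikovPandeySchreyer2019, §7.3 (statement 26, LRC(α,β))] -/
def latinRectangleCondition (α β : ℕ) : Prop :=
  latinRectSumPoly α β ≠ 0

end LatinRectangles

/-- **BILPS Thm 27 (equations from rectangular designs).** "Let `m ≤ n`. If `m, n > kr` and if
`LRC(k, m)` holds, then there exists an irreducible representation of nontrivial equations for `𝓜_r`
in degree `km` of type `((k × m), (m × k), (m × k))`. Note that for `m = n` this means that the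
equation is an `GL(U) × GL(V) × GL(W)`-invariant polynomial." (p0026:L36). TYPED WEAKER (faithfulness
sheet): the conclusion retained is the existence of a nontrivial equation of `𝓜_r` that is
homogeneous of degree `km` (the `GL × GL × GL`-isotypic type `((k×m),(m×k),(m×k))` of the
representation it spans is not typed); over an algebraically closed field of characteristic `0`.
[cite: BlaserIkenmeyerLysikovPandeySchreyer2019, Thm. 27] -/
def BILPS2019_thm27 : Prop :=
  ∀ (F : Type) [Field F] [IsAlgClosed F] [CharZero F] (k m n r : ℕ), m ≤ n → k * r < m →
    k * r < n → latinRectangleCondition k m →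
      ∃ f : MvPolynomial (Fin k × Fin m × Fin n) F, f ≠ 0 ∧ f.IsHomogeneous (k * m) ∧
        ∀ T ∈ (minrankSet F r : Set (Fin k → Fin m → Fin n → F)), eval (trilinearPt T) f = 0

end Literature.Computability.AlgebraicComplexity
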